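import Literature.AnabelianGeometry.AbsoluteAnabelian.AbsTopICharacterRankAdmissible
import HarnessLib

/-!
# [AbsTopI] Lemma 4.5 (ii): the quasi-trivial rank `τ` is ADDITIVE in short exact sequences

Proof-only companion of `AbsTopICharacterRank.lean` (S. Mochizuki, *Topics in Absolute Anabelian
Geometry I: Generalities* [MochizukiAbsTopI2012], Lemma 4.5 (ii), kurims manuscript p. 54; the
quasi-trivial rank `τ(M)` is [CombGC] Def. 2.3 (i)), cell abc-iut, block F, seat abc-iut-f-062.
For a stable submodule `N ⊆ M` of a finite-dimensional representation `ρ`, and representations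
`ρN` on `N` and `ρQ` on `M/N` intertwined with `ρ` by the inclusion and the projection,

  **`τ(M) = τ(N) + τ(M/N)`** (`quasiTrivialRank_eq_add_of_exact`),

the additivity that the weight-rank calculus of [CombGC] §2 (Def. 2.3 (ii), Prop. 2.4) uses silently
whenever ranks of subquotients are added; in particular `τ(V ⊕ ℚ_l) = τ(V) + τ(ℚ_l)` for the module
"`(H^{ab} ⊗ ℚ_l) ⊕ ℚ_l`" of [AbsTopI] Lemma 4.5 (iii) is the case `N = V ⊕ 0`.  Proof (no Jordan–Hölder):
`≤` by splitting every stable filtration `d` of `M` along `N` into the filtrations `d ⊓ N` of `N` and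
`(d ⊔ N)/N` of `M/N` (modular-lattice identity `dim(A ⊔ N) + dim(A ⊓ N) = dim A + dim N`, quasi-trivial
steps pass to both halves); `≥` by concatenating the pull-back of a filtration of `M/N` with the
push-forward of a filtration of `N`.  No new definitions: `ρN`, `ρQ` are ARBITRARY representations
subject to the two intertwining hypotheses (so the statement applies verbatim to any model of the
subrepresentation / quotient representation).  HONEST FRAMING: refereed pre-IUT anabelian geometry;
nothing here bears on [IUTchIII] Cor. 3.12.
-/

noncomputable section

open scoped Classical

namespace Literature.AnabelianGeometry.AbsoluteAnabelian.AbsTopI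

universe u v w

section Additive

variable {G : Type u} [Group G] [TopologicalSpace G]
variable {K : Type v} [Field K] {M : Type w} [AddCommGroup M] [Module K M]

/-! ### Dimension bookkeeping along `N ↪ M ↠ M/N` -/

omit [TopologicalSpace G] in
/-- `dim(P.map N.mkQ) + dim N = dim(P ⊔ N)`. [cite: MochizukiAbsTopI2012, Lemma 4.5 (ii) p.54] -/
theorem finrank_map_mkQ_add_finrank [FiniteDimensional K M] (P N : Submodule K M) :
    Module.finrank K ↥(P.map N.mkQ) + Module.finrank K ↥N = Module.finrank K ↥(P ⊔ N) := by
  -- `P.map N.mkQ = (P ⊔ N).map N.mkQ` is the range of `mkQ ∘ (P ⊔ N).subtype`, whose kernel is `N`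
  set f : ↥(P ⊔ N) →ₗ[K] M ⧸ N := N.mkQ.comp (P ⊔ N).subtype with hf
  have hrange : LinearMap.range f = P.map N.mkQ := by
    rw [hf, LinearMap.range_comp, Submodule.range_subtype, Submodule.map_sup, Submodule.mkQ_map_self,
      sup_bot_eq]
  have hker : LinearMap.ker f = N.comap (P ⊔ N).subtype := by
    rw [hf, LinearMap.ker_comp, Submodule.ker_mkQ]
  have hkdim : Module.finrank K ↥(LinearMap.ker f) = Module.finrank K ↥N := by
    rw [hker]
    exact (Submodule.comapSubtypeEquivOfLe (le_sup_right : N ≤ P ⊔ N)).finrank_eq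
  have h := LinearMap.finrank_range_add_finrank_ker f
  rw [hrange, hkdim] at h
  exact h

omit [TopologicalSpace G] in
/-- `dim(Q.comap N.mkQ) = dim Q + dim N` for `Q ⊆ M/N`. [cite: MochizukiAbsTopI2012, Lemma 4.5 (ii) p.54] -/
theorem finrank_comap_mkQ [FiniteDimensional K M] (N : Submodule K M) (Q : Submodule K (M ⧸ N)) :
    Module.finrank K ↥(Q.comap N.mkQ) = Module.finrank K ↥Q + Module.finrank K ↥N := by
  have h := finrank_map_mkQ_add_finrank (Q.comap N.mkQ) N
  have hle : N ≤ Q.comap N.mkQ := by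
    intro x hx
    rw [Submodule.mem_comap]
    have hx0 : N.mkQ x = 0 := (Submodule.Quotient.mk_eq_zero N).2 hx
    rw [hx0]
    exact Q.zero_mem
  rw [Submodule.map_comap_eq_of_surjective N.mkQ_surjective, sup_eq_left.2 hle] at h
  exact h.symm

/-! ### `τ(M) ≤ τ(N) + τ(M/N)`: split a filtration of `M` along `N` -/

/-- Every stable filtration's quasi-trivial total splits along a stable `N`: it is at most the total
of the cut-down family `d ⊓ N` plus the total of the family `d ⊔ N`.
[cite: MochizukiAbsTopI2012, Lemma 4.5 (ii) p.54] -/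
theorem StableChain.qtDim_le_inf_add_sup [FiniteDimensional K M] {ρ : G →* (M ≃ₗ[K] M)}
    (d : StableChain ρ) {N : Submodule K M} (hN : IsStable ρ N) :
    d.qtDim ≤
      (∑ i ∈ Finset.range d.length,
        if IsQuasiTrivialStep ρ (d.term i ⊓ N) (d.term (i + 1) ⊓ N) then
          Module.finrank K ↥(d.term i ⊓ N) - Module.finrank K ↥(d.term (i + 1) ⊓ N) else 0) +
      ∑ i ∈ Finset.range d.length,
        if IsQuasiTrivialStep ρ (d.term i ⊔ N) (d.term (i + 1) ⊔ N) then
          Module.finrank K ↥(d.term i ⊔ N) - Module.finrank K ↥(d.term (i + 1) ⊔ N) else 0 := by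
  unfold StableChain.qtDim
  rw [← Finset.sum_add_distrib]
  refine Finset.sum_le_sum fun i hi => ?_
  have hi' : i < d.length := Finset.mem_range.1 hi
  by_cases hq : IsQuasiTrivialStep ρ (d.term i) (d.term (i + 1))
  · rw [if_pos hq, if_pos (hq.inf_right hN), if_pos (hq.sup_right hN),
      finrank_sub_finrank_eq_inf_add_sup (d.step_le i hi') N]
  · rw [if_neg hq]; exact Nat.zero_le _

/-- The cut-down family `d ⊓ N` is (pulled back to `N`) a stable filtration of the subrepresentation,
so its quasi-trivial total is at most `τ(N)`. [cite: MochizukiAbsTopI2012, Lemma 4.5 (ii) p.54] -/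
theorem StableChain.sum_inf_le_quasiTrivialRank [FiniteDimensional K M] {ρ : G →* (M ≃ₗ[K] M)}
    (d : StableChain ρ) {N : Submodule K M} (ρN : G →* (↥N ≃ₗ[K] ↥N))
    (hρN : ∀ (g : G) (n : ↥N), ((ρN g n : ↥N) : M) = ρ g n) :
    (∑ i ∈ Finset.range d.length,
        if IsQuasiTrivialStep ρ (d.term i ⊓ N) (d.term (i + 1) ⊓ N) then
          Module.finrank K ↥(d.term i ⊓ N) - Module.finrank K ↥(d.term (i + 1) ⊓ N) else 0) ≤
      quasiTrivialRank ρN := by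
  -- the filtration of `N`
  let dN : StableChain ρN :=
    { length := d.length
      term := fun i => (d.term i ⊓ N).comap N.subtype
      term_zero := by rw [d.term_zero, top_inf_eq, Submodule.comap_subtype_self]
      term_length := by rw [d.term_length, bot_inf_eq, Submodule.comap_bot, Submodule.ker_subtype]
      step_le := fun j hj => Submodule.comap_mono (inf_le_inf_right N (d.step_le j hj))
      stable := by
        intro j g n hn
        rw [Submodule.mem_comap, Submodule.subtype_apply] at hn ⊢
        rw [hρN]
        exact Submodule.mem_inf.2 ⟨d.stable j g _ (Submodule.mem_inf.1 hn).1, by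
          rw [← hρN]; exact (ρN g n).2⟩ }
  have hdim : ∀ i, Module.finrank K ↥(dN.term i) = Module.finrank K ↥(d.term i ⊓ N) := fun i =>
    (Submodule.comapSubtypeEquivOfLe (inf_le_right : d.term i ⊓ N ≤ N)).finrank_eq
  have hqt : ∀ i, IsQuasiTrivialStep ρ (d.term i ⊓ N) (d.term (i + 1) ⊓ N) →
      IsQuasiTrivialStep ρN (dN.term i) (dN.term (i + 1)) := by
    rintro i ⟨U, hU, hfi, hact⟩
    refine ⟨U, hU, hfi, fun g hg n hn => ?_⟩
    rw [Submodule.mem_comap, Submodule.subtype_apply] at hn ⊢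
    have e : ((ρN g n - n : ↥N) : M) = ρ g n - n := by rw [Submodule.coe_sub, hρN]
    rw [e]
    exact hact g hg _ hn
  have hle : (∑ i ∈ Finset.range d.length,
      if IsQuasiTrivialStep ρ (d.term i ⊓ N) (d.term (i + 1) ⊓ N) then
        Module.finrank K ↥(d.term i ⊓ N) - Module.finrank K ↥(d.term (i + 1) ⊓ N) else 0) ≤
      dN.qtDim := by
    unfold StableChain.qtDim
    refine Finset.sum_le_sum fun i _ => ?_
    by_cases hq : IsQuasiTrivialStep ρ (d.term i ⊓ N) (d.term (i + 1) ⊓ N)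
    · rw [if_pos hq, if_pos (hqt i hq), hdim, hdim]
    · rw [if_neg hq]; exact Nat.zero_le _
  exact hle.trans dN.qtDim_le_quasiTrivialRank

/-- The family `d ⊔ N` is (pushed to `M/N`) a stable filtration of the quotient representation, so
its quasi-trivial total is at most `τ(M/N)`. [cite: MochizukiAbsTopI2012, Lemma 4.5 (ii) p.54] -/
theorem StableChain.sum_sup_le_quasiTrivialRank [FiniteDimensional K M] {ρ : G →* (M ≃ₗ[K] M)}
    (d : StableChain ρ) {N : Submodule K M} (ρQ : G →* ((M ⧸ N) ≃ₗ[K] (M ⧸ N)))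
    (hρQ : ∀ (g : G) (m : M), ρQ g (N.mkQ m) = N.mkQ (ρ g m)) :
    (∑ i ∈ Finset.range d.length,
        if IsQuasiTrivialStep ρ (d.term i ⊔ N) (d.term (i + 1) ⊔ N) then
          Module.finrank K ↥(d.term i ⊔ N) - Module.finrank K ↥(d.term (i + 1) ⊔ N) else 0) ≤
      quasiTrivialRank ρQ := by
  -- the filtration of `M/N`
  let dQ : StableChain ρQ :=
    { length := d.length
      term := fun i => (d.term i).map N.mkQ
      term_zero := by rw [d.term_zero, Submodule.map_top, Submodule.range_mkQ]
      term_length := by rw [d.term_length, Submodule.map_bot]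
      step_le := fun j hj => Submodule.map_mono (d.step_le j hj)
      stable := by
        intro j g x hx
        obtain ⟨m, hm, rfl⟩ := Submodule.mem_map.1 hx
        exact Submodule.mem_map.2 ⟨ρ g m, d.stable j g m hm, (hρQ g m).symm⟩ }
  have hdim : ∀ i, Module.finrank K ↥(dQ.term i) + Module.finrank K ↥N =
      Module.finrank K ↥(d.term i ⊔ N) := fun i => finrank_map_mkQ_add_finrank (d.term i) N
  have hqt : ∀ i, IsQuasiTrivialStep ρ (d.term i ⊔ N) (d.term (i + 1) ⊔ N) →
      IsQuasiTrivialStep ρQ (dQ.term i) (dQ.term (i + 1)) := by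
    rintro i ⟨U, hU, hfi, hact⟩
    refine ⟨U, hU, hfi, fun g hg x hx => ?_⟩
    obtain ⟨m, hm, rfl⟩ := Submodule.mem_map.1 hx
    have hstep := hact g hg m (Submodule.mem_sup_left hm)
    obtain ⟨p, hp, n, hn, hpn⟩ := Submodule.mem_sup.1 hstep
    refine Submodule.mem_map.2 ⟨p, hp, ?_⟩
    have hn0 : N.mkQ n = 0 := (Submodule.Quotient.mk_eq_zero N).2 hn
    have e1 : N.mkQ p = N.mkQ (ρ g m - m) := by rw [← hpn, map_add, hn0, add_zero]
    rw [e1, map_sub, ← hρQ]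
  have hle : (∑ i ∈ Finset.range d.length,
      if IsQuasiTrivialStep ρ (d.term i ⊔ N) (d.term (i + 1) ⊔ N) then
        Module.finrank K ↥(d.term i ⊔ N) - Module.finrank K ↥(d.term (i + 1) ⊔ N) else 0) ≤
      dQ.qtDim := by
    unfold StableChain.qtDim
    refine Finset.sum_le_sum fun i _ => ?_
    by_cases hq : IsQuasiTrivialStep ρ (d.term i ⊔ N) (d.term (i + 1) ⊔ N)
    · rw [if_pos hq, if_pos (hqt i hq)]
      have h1 := hdim i
      have h2 := hdim (i + 1)
      omega
    · rw [if_neg hq]; exact Nat.zero_le _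
  exact hle.trans dQ.qtDim_le_quasiTrivialRank

/-- **`τ(M) ≤ τ(N) + τ(M/N)`.** [cite: MochizukiAbsTopI2012, Lemma 4.5 (ii) p.54] -/
theorem quasiTrivialRank_le_add_of_exact [FiniteDimensional K M] (ρ : G →* (M ≃ₗ[K] M))
    {N : Submodule K M} (hN : IsStable ρ N) (ρN : G →* (↥N ≃ₗ[K] ↥N))
    (hρN : ∀ (g : G) (n : ↥N), ((ρN g n : ↥N) : M) = ρ g n)
    (ρQ : G →* ((M ⧸ N) ≃ₗ[K] (M ⧸ N))) (hρQ : ∀ (g : G) (m : M), ρQ g (N.mkQ m) = N.mkQ (ρ g m)) :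
    quasiTrivialRank ρ ≤ quasiTrivialRank ρN + quasiTrivialRank ρQ := by
  refine csSup_le ⟨_, ⟨StableChain.trivial ρ, rfl⟩⟩ ?_
  rintro _ ⟨d, rfl⟩
  exact (d.qtDim_le_inf_add_sup hN).trans
    (add_le_add (d.sum_inf_le_quasiTrivialRank ρN hρN) (d.sum_sup_le_quasiTrivialRank ρQ hρQ))

/-! ### `τ(N) + τ(M/N) ≤ τ(M)`: concatenate filtrations of `M/N` and `N` -/

/-- Concatenation: a stable filtration `b` of `M/N` (pulled back to `M`, from `M` down to `N`) followed
by a stable filtration `a` of `N` (pushed into `M`, from `N` down to `0`) is a stable filtration of `M`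
whose quasi-trivial total is at least `qtDim b + qtDim a`. [cite: MochizukiAbsTopI2012, Lemma 4.5 (ii) p.54] -/
theorem StableChain.exists_concat_qtDim_ge [FiniteDimensional K M] {ρ : G →* (M ≃ₗ[K] M)}
    {N : Submodule K M} {ρN : G →* (↥N ≃ₗ[K] ↥N)}
    (hρN : ∀ (g : G) (n : ↥N), ((ρN g n : ↥N) : M) = ρ g n)
    {ρQ : G →* ((M ⧸ N) ≃ₗ[K] (M ⧸ N))} (hρQ : ∀ (g : G) (m : M), ρQ g (N.mkQ m) = N.mkQ (ρ g m))
    (a : StableChain ρN) (b : StableChain ρQ) :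
    ∃ e : StableChain ρ, b.qtDim + a.qtDim ≤ e.qtDim := by
  -- degenerate bookkeeping: if `a` has length `0` then `N = 0`
  have hN0 : a.length = 0 → N = ⊥ := by
    intro h0
    have htop : (⊤ : Submodule K ↥N) = ⊥ := by rw [← a.term_zero, ← a.term_length, h0]
    rw [eq_bot_iff]
    intro x hx
    have : (⟨x, hx⟩ : ↥N) ∈ (⊤ : Submodule K ↥N) := Submodule.mem_top
    rw [htop, Submodule.mem_bot] at this
    rw [Submodule.mem_bot]
    exact congrArg Subtype.val this
  -- pulled-back terms are stable, pushed terms are stable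
  have hstQ : ∀ j, IsStable ρ ((b.term j).comap N.mkQ) := by
    intro j g m hm
    rw [Submodule.mem_comap] at hm ⊢
    rw [← hρQ]
    exact b.stable j g _ hm
  have hstN : ∀ i, IsStable ρ ((a.term i).map N.subtype) := by
    intro i g m hm
    obtain ⟨n, hn, rfl⟩ := Submodule.mem_map.1 hm
    exact Submodule.mem_map.2 ⟨ρN g n, a.stable i g n hn, by rw [Submodule.subtype_apply, hρN]; rfl⟩
  have hcomap_len : (b.term b.length).comap N.mkQ = N := by
    rw [b.term_length, Submodule.comap_bot, Submodule.ker_mkQ]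
  let e : StableChain ρ :=
    { length := b.length + a.length
      term := fun j => if j ≤ b.length then (b.term j).comap N.mkQ else (a.term (j - b.length)).map N.subtype
      term_zero := by
        rw [if_pos (Nat.zero_le _), b.term_zero, Submodule.comap_top]
      term_length := by
        by_cases h0 : a.length = 0
        · rw [if_pos (by omega), show b.length + a.length = b.length by omega, hcomap_len, hN0 h0]
        · rw [if_neg (by omega), show b.length + a.length - b.length = a.length by omega, a.term_length,
            Submodule.map_bot]
      step_le := by
        intro j hj
        by_cases h1 : j + 1 ≤ b.length
        · rw [if_pos h1, if_pos (by omega)]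
          exact Submodule.comap_mono (b.step_le j (by omega))
        · by_cases h2 : j ≤ b.length
          · have hj' : j = b.length := by omega
            subst hj'
            rw [if_neg h1, if_pos le_rfl, hcomap_len]
            exact Submodule.map_subtype_le N _
          · rw [if_neg h1, if_neg h2, show j + 1 - b.length = (j - b.length) + 1 by omega]
            exact Submodule.map_mono (a.step_le (j - b.length) (by omega))
      stable := by
        intro j
        by_cases h : j ≤ b.length
        · simp only [if_pos h]; exact hstQ j
        · simp only [if_neg h]; exact hstN _ }
  refine ⟨e, ?_⟩
  -- the terms of `e` on the two ranges
  have heQ : ∀ j ≤ b.length, e.term j = (b.term j).comap N.mkQ := fun j hj => if_pos hj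
  have heN : ∀ i ≤ a.length, e.term (b.length + i) = (a.term i).map N.subtype := by
    intro i hi
    by_cases hi0 : i = 0
    · subst hi0
      change (if b.length + 0 ≤ b.length then (b.term (b.length + 0)).comap N.mkQ
        else (a.term (b.length + 0 - b.length)).map N.subtype) = _
      rw [if_pos (by omega), show b.length + 0 = b.length from rfl, hcomap_len, a.term_zero,
        Submodule.map_top, Submodule.range_subtype]
    · change (if b.length + i ≤ b.length then (b.term (b.length + i)).comap N.mkQ
        else (a.term (b.length + i - b.length)).map N.subtype) = _
      rw [if_neg (by omega), show b.length + i - b.length = i by omega]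
  -- quasi-trivial steps transfer along pull-back and push-forward
  have hqtQ : ∀ j, IsQuasiTrivialStep ρQ (b.term j) (b.term (j + 1)) →
      IsQuasiTrivialStep ρ ((b.term j).comap N.mkQ) ((b.term (j + 1)).comap N.mkQ) := by
    rintro j ⟨U, hU, hfi, hact⟩
    refine ⟨U, hU, hfi, fun g hg m hm => ?_⟩
    rw [Submodule.mem_comap] at hm ⊢
    have := hact g hg _ hm
    rw [map_sub, ← hρQ]
    exact this
  have hqtN : ∀ i, IsQuasiTrivialStep ρN (a.term i) (a.term (i + 1)) →
      IsQuasiTrivialStep ρ ((a.term i).map N.subtype) ((a.term (i + 1)).map N.subtype) := by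
    rintro i ⟨U, hU, hfi, hact⟩
    refine ⟨U, hU, hfi, fun g hg m hm => ?_⟩
    obtain ⟨n, hn, rfl⟩ := Submodule.mem_map.1 hm
    refine Submodule.mem_map.2 ⟨ρN g n - n, hact g hg n hn, ?_⟩
    rw [Submodule.subtype_apply, Submodule.coe_sub, hρN, Submodule.subtype_apply]
  -- dimensions along pull-back and push-forward
  have hdimQ : ∀ j, Module.finrank K ↥((b.term j).comap N.mkQ) =
      Module.finrank K ↥(b.term j) + Module.finrank K ↥N := fun j => finrank_comap_mkQ N (b.term j)
  have hdimN : ∀ i, Module.finrank K ↥((a.term i).map N.subtype) = Module.finrank K ↥(a.term i) :=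
    fun i => Submodule.finrank_map_subtype_eq N (a.term i)
  -- split `e.qtDim` into the two ranges
  unfold StableChain.qtDim
  rw [show e.length = b.length + a.length from rfl, Finset.sum_range_add]
  refine add_le_add (Finset.sum_le_sum fun j hj => ?_) (Finset.sum_le_sum fun i hi => ?_)
  · have hj' : j < b.length := Finset.mem_range.1 hj
    rw [heQ j hj'.le, heQ (j + 1) (by omega)]
    by_cases hq : IsQuasiTrivialStep ρQ (b.term j) (b.term (j + 1))
    · rw [if_pos hq, if_pos (hqtQ j hq), hdimQ, hdimQ]
      omega
    · rw [if_neg hq]; exact Nat.zero_le _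
  · have hi' : i < a.length := Finset.mem_range.1 hi
    rw [heN i hi'.le, show b.length + i + 1 = b.length + (i + 1) by omega, heN (i + 1) (by omega)]
    by_cases hq : IsQuasiTrivialStep ρN (a.term i) (a.term (i + 1))
    · rw [if_pos hq, if_pos (hqtN i hq), hdimN, hdimN]
    · rw [if_neg hq]; exact Nat.zero_le _

/-- **`τ(N) + τ(M/N) ≤ τ(M)`.** [cite: MochizukiAbsTopI2012, Lemma 4.5 (ii) p.54] -/
theorem add_le_quasiTrivialRank_of_exact [FiniteDimensional K M] (ρ : G →* (M ≃ₗ[K] M))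
    {N : Submodule K M} (ρN : G →* (↥N ≃ₗ[K] ↥N))
    (hρN : ∀ (g : G) (n : ↥N), ((ρN g n : ↥N) : M) = ρ g n)
    (ρQ : G →* ((M ⧸ N) ≃ₗ[K] (M ⧸ N))) (hρQ : ∀ (g : G) (m : M), ρQ g (N.mkQ m) = N.mkQ (ρ g m)) :
    quasiTrivialRank ρN + quasiTrivialRank ρQ ≤ quasiTrivialRank ρ := by
  -- every pair of filtrations is dominated by a filtration of `M`
  have key : ∀ (a : StableChain ρN) (b : StableChain ρQ), b.qtDim + a.qtDim ≤ quasiTrivialRank ρ := by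
    intro a b
    obtain ⟨e, he⟩ := StableChain.exists_concat_qtDim_ge hρN hρQ a b
    exact he.trans e.qtDim_le_quasiTrivialRank
  have hQ : ∀ b : StableChain ρQ, b.qtDim ≤ quasiTrivialRank ρ := fun b =>
    le_trans (Nat.le_add_right _ _) (key (StableChain.trivial ρN) b)
  have hN : ∀ b : StableChain ρQ, quasiTrivialRank ρN ≤ quasiTrivialRank ρ - b.qtDim := fun b =>
    csSup_le ⟨_, ⟨StableChain.trivial ρN, rfl⟩⟩ (by
      rintro _ ⟨a, rfl⟩
      have := key a b
      omega)
  have hQ' : quasiTrivialRank ρQ ≤ quasiTrivialRank ρ - quasiTrivialRank ρN :=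
    csSup_le ⟨_, ⟨StableChain.trivial ρQ, rfl⟩⟩ (by
      rintro _ ⟨b, rfl⟩
      have h1 := hN b
      have h2 := hQ b
      omega)
  have h0 := hN (StableChain.trivial ρQ)
  have h0' := hQ (StableChain.trivial ρQ)
  omega

/-- **[AbsTopI] Lemma 4.5 (ii) / [CombGC] Def. 2.3 (i): the quasi-trivial rank is ADDITIVE in short
exact sequences** — for a stable `N ⊆ M` of a finite-dimensional representation `ρ` and ANY
representations `ρN` on `N`, `ρQ` on `M/N` intertwined with `ρ` by the inclusion and the projection,
`τ(M) = τ(N) + τ(M/N)`. [cite: MochizukiAbsTopI2012, Lemma 4.5 (ii) p.54]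
[cite: MochizukiCombGC2007, Def. 2.3 (i) p.18] -/
theorem quasiTrivialRank_eq_add_of_exact [FiniteDimensional K M] (ρ : G →* (M ≃ₗ[K] M))
    {N : Submodule K M} (hN : IsStable ρ N) (ρN : G →* (↥N ≃ₗ[K] ↥N))
    (hρN : ∀ (g : G) (n : ↥N), ((ρN g n : ↥N) : M) = ρ g n)
    (ρQ : G →* ((M ⧸ N) ≃ₗ[K] (M ⧸ N))) (hρQ : ∀ (g : G) (m : M), ρQ g (N.mkQ m) = N.mkQ (ρ g m)) :
    quasiTrivialRank ρ = quasiTrivialRank ρN + quasiTrivialRank ρQ :=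
  le_antisymm (quasiTrivialRank_le_add_of_exact ρ hN ρN hρN ρQ hρQ)
    (add_le_quasiTrivialRank_of_exact ρ ρN hρN ρQ hρQ)

/-- In particular `τ(N) ≤ τ(M)` and `τ(M/N) ≤ τ(M)` (monotonicity of the quasi-trivial rank under
stable subobjects and quotients). [cite: MochizukiAbsTopI2012, Lemma 4.5 (ii) p.54] -/
theorem quasiTrivialRank_sub_le_and_quot_le [FiniteDimensional K M] (ρ : G →* (M ≃ₗ[K] M))
    {N : Submodule K M} (hN : IsStable ρ N) (ρN : G →* (↥N ≃ₗ[K] ↥N))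
    (hρN : ∀ (g : G) (n : ↥N), ((ρN g n : ↥N) : M) = ρ g n)
    (ρQ : G →* ((M ⧸ N) ≃ₗ[K] (M ⧸ N))) (hρQ : ∀ (g : G) (m : M), ρQ g (N.mkQ m) = N.mkQ (ρ g m)) :
    quasiTrivialRank ρN ≤ quasiTrivialRank ρ ∧ quasiTrivialRank ρQ ≤ quasiTrivialRank ρ := by
  have h := quasiTrivialRank_eq_add_of_exact ρ hN ρN hρN ρQ hρQ
  constructor <;> omega

end Additive

end Literature.AnabelianGeometry.AbsoluteAnabelian.AbsTopI

end
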